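import Summits.RiemannHypothesis.RiemannHypothesis.Theorems.HandoffDecompositionConsequences
import Summits.RiemannHypothesis.RiemannHypothesis.Theorems.HandoffHybridTarget
import Summits.RiemannHypothesis.RiemannHypothesis.Theorems.SoloInformedOnset
import HarnessLib

/-!
# TRACK «HANDOFF» — the failing step: at most ONE handoff increment can fail (theory-1 gen5, file X)

Statement-level consequences of the tree's rungs for the INCREMENT form of the handoff decomposition
(`HandoffDecomposition.lean` §B.3′, `HandoffDecompositionConsequences.lean` §2), no new analysis.

Write `H(q) = HandoffH q` (Weil positivity on `C((log q⁺)/2)`, `q⁺ = nextPrime q`) and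
`H′(q) = HandoffStep q := WeilPositivityOn ((log q)/2) → H(q)` (the increment across the window of `q`).

* §1 `riemannHypothesis_iff_forall_handoffStep` — `RH ↔ ∀ q prime, H′(q)`: in the increment form
  `RH ↔ Base ∧ ∀ q prime, H′(q)` the clause `Base` is DISCHARGED (Yoshida 1992 Thm 1 is the tree theorem
  `handoffBase_holds`), so it can be dropped from the statement (it remains essential to the SHAPE of the induction).
* §2 `eq_of_not_handoffStep` — UNCONDITIONALLY, the increment fails at AT MOST ONE prime: if `¬H′(q₁)` and
  `¬H′(q₂)` for primes `q₁, q₂` then `q₁ = q₂` (window monotonicity: a failure at `q₁ < q₂` makes the hypothesis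
  of `H′(q₂)` false).  With §2 of file B: `not_riemannHypothesis_iff_existsUnique_not_handoffStep` —
  `¬RH ↔ ∃! q, q prime ∧ ¬H′(q)`, and that prime is `≥ 3` (`three_le_of_not_handoffStep`, from the rung `H(2)`).
  So the whole content of RH sits in ONE increment at ONE (unknown) prime; this is the sharp form of the
  VACUITY TRAP `exists_forall_handoffStep`.
* §3 `forall_ge_handoffStep_iff` — the exact content of a TAIL of increments: for a prime `q₀`,
  `(∀ primes q ≥ q₀, H′(q)) ↔ (WeilPositivityOn ((log q₀)/2) → RH)`; i.e. «the increment for all `q ≥ q₀`» is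
  precisely «the rung at `q₀` implies RH» (the hybrid target `HandoffHybridTarget.lean` read as an equivalence of
  the tail itself).
* §4 the ONSET dictionary (solo-informed T56, `SoloInformedOnset.lean`): for an onset window `a₀`
  (`IsWeilOnset a₀`: `ε ≥ 0` on `(0, a₀]`, `ε(a₀) = 0`, `ε < 0` beyond), `H(q) ↔ (log q⁺)/2 ≤ a₀` and
  `¬H′(q) ↔ (log q)/2 ≤ a₀ < (log q⁺)/2` — the failing step is the prime whose window contains the onset
  (`HANDOFF-STATEMENT.md` §B.5, now a kernel statement).
* §5 (appended, theory-1 gen8; RH-PROMISE § 0′ T3 «is an ‹H(q) for all q ≥ Q₀› theorem RH-equivalent?») TAILS AND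
  INFINITE SETS OF `H` ITSELF: since `H` is cumulative (`HandoffH.anti`), **`riemannHypothesis_iff_forall_ge_handoffH` —
  `RH ↔ ∀ primes q ≥ Q, H(q)` for EVERY `Q`**, and **`riemannHypothesis_iff_forall_exists_ge_handoffH` — `RH ↔ H(q)` at
  infinitely many primes** (so «almost all», «positive density», «some arithmetic progression» versions of `H` are all RH);
  under `¬RH`, `H` fails at every prime from the failing one on (`exists_forall_ge_not_handoffH_of_not_riemannHypothesis`).
  Contrast §3: a tail of INCREMENTS `H′` is worth exactly «rung at `q₀` ⟹ RH», not RH.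

References: E. Bombieri, Rend. Mat. Acc. Lincei (9) 11 (2000) Thm 2, §4 (key `Bombieri2000Weil`); H. Yoshida,
Adv. Stud. Pure Math. 21 (1992) 281–325, Thm 1 (p. 310), Prop. 6 (p. 320) (key `Yoshida1992HermitianForms`); this track (theory-1).
Nothing here is a step towards RH: every statement is a re-reading of `RH ↔ ∀ q prime, H(q)`.
-/

set_option linter.dupNamespace false  -- the mandated namespace repeats `RiemannHypothesis`

noncomputable section

open Set Literature.NumberTheory.LFunctions

namespace Summit.RiemannHypothesis.RiemannHypothesis.Theorems

namespace HandoffDecomposition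

variable {q q₀ q₁ q₂ : ℕ} {a₀ : ℝ}

/-! ## §1 Base discharged -/

/-- **`RH ↔ ∀ q prime, H′(q)`.**  The increment form `riemannHypothesis_iff_base_and_forall_handoffStep` with its
`Base` clause discharged by the tree theorem `handoffBase_holds` (Yoshida 1992 Thm 1).
[cite: Yoshida1992HermitianForms, Thm. 1 (p. 310); Bombieri2000Weil, Thm. 2] -/
theorem riemannHypothesis_iff_forall_handoffStep :
    Summit.RiemannHypothesis ↔ ∀ q : ℕ, q.Prime → HandoffStep q := by
  rw [riemannHypothesis_iff_base_and_forall_handoffStep]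
  exact ⟨fun h ↦ h.2, fun h ↦ ⟨handoffBase_holds, h⟩⟩

/-- `(log p)/2 > 0` for a prime `p` (window bookkeeping). [folklore] -/
theorem log_half_pos_of_prime (hq : q.Prime) : 0 < Real.log q / 2 := by
  have := Real.log_pos (show (1 : ℝ) < q by exact_mod_cast hq.one_lt)
  positivity

/-- Window monotonicity across a gap: for `q₁ < q₂` with `q₂` prime, `q₁⁺ ≤ q₂`, so Weil positivity on
`C((log q₂)/2)` gives it on `C((log q₁⁺)/2)`. [folklore] -/
theorem weilPositivityOn_nextPrime_of_lt (hq₂ : q₂.Prime) (hlt : q₁ < q₂)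
    (h : WeilPositivityOn (Real.log q₂ / 2)) : WeilPositivityOn (Real.log (nextPrime q₁) / 2) := by
  refine h.mono ?_
  have h1 : (nextPrime q₁ : ℝ) ≤ q₂ := by exact_mod_cast nextPrime_le hq₂ hlt
  have h0 : (0 : ℝ) < nextPrime q₁ := by exact_mod_cast (nextPrime_prime q₁).pos
  linarith [Real.log_le_log h0 h1]

/-! ## §2 At most one increment fails -/

/-- Unfolding a FAILED increment at a prime `q`: the old form is non-negative on `C((log q)/2)` and Weil positivity
fails on `C((log q⁺)/2)`. [this track (theory-1)] -/
theorem not_handoffStep_iff (hq : q.Prime) :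
    ¬ HandoffStep q ↔
      WeilPositivityOn (Real.log q / 2) ∧ ¬ WeilPositivityOn (Real.log (nextPrime q) / 2) := by
  rw [HandoffStep, handoffH_iff_weilPositivityOn hq, Classical.not_imp]

/-- **AT MOST ONE INCREMENT CAN FAIL** (unconditional): if the handoff increment fails at primes `q₁` and `q₂`
then `q₁ = q₂`.  (If `q₁ < q₂`, the hypothesis `WeilPositivityOn((log q₂)/2)` of the failure at `q₂` gives
`WeilPositivityOn((log q₁⁺)/2) = H(q₁)`, contradicting the failure at `q₁`.) [this track (theory-1)] -/
theorem eq_of_not_handoffStep (hq₁ : q₁.Prime) (hq₂ : q₂.Prime) (h₁ : ¬ HandoffStep q₁)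
    (h₂ : ¬ HandoffStep q₂) : q₁ = q₂ := by
  rw [not_handoffStep_iff hq₁] at h₁
  rw [not_handoffStep_iff hq₂] at h₂
  by_contra hne
  rcases lt_or_gt_of_ne hne with hlt | hgt
  · exact h₁.2 (weilPositivityOn_nextPrime_of_lt hq₂ hlt h₂.1)
  · exact h₂.2 (weilPositivityOn_nextPrime_of_lt hq₁ hgt h₁.1)

/-- The set of primes at which the increment fails has at most one element. [this track (theory-1)] -/
theorem setOf_not_handoffStep_subsingleton : ({q : ℕ | q.Prime ∧ ¬ HandoffStep q} : Set ℕ).Subsingleton :=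
  fun _ h₁ _ h₂ ↦ eq_of_not_handoffStep h₁.1 h₂.1 h₁.2 h₂.2

/-- A failed increment sits at a prime `≥ 3`: the increment at `2` holds outright (`handoffH_two`, the tree's rung
`WeilPositivityOn((log 3)/2)`). [cite: Yoshida1992HermitianForms, Thm. 1 (p. 310)] -/
theorem three_le_of_not_handoffStep (hq : q.Prime) (h : ¬ HandoffStep q) : 3 ≤ q := by
  by_contra h3
  have h2 : q = 2 := by
    have := hq.two_le
    omega
  subst h2
  exact h fun _ ↦ handoffH_two

/-- The increment holds at `2`. [cite: Yoshida1992HermitianForms, Thm. 1 (p. 310)] -/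
theorem handoffStep_two : HandoffStep 2 := fun _ ↦ handoffH_two

/-- Under `¬RH` some increment fails — at the first failing prime of file B's
`exists_first_failure_of_not_riemannHypothesis` (its predecessor prime supplies the hypothesis). [this track] -/
theorem exists_not_handoffStep_of_not_riemannHypothesis (hRH : ¬ Summit.RiemannHypothesis) :
    ∃ q : ℕ, q.Prime ∧ ¬ HandoffStep q := by
  by_contra h
  push Not at h
  exact hRH (riemannHypothesis_iff_forall_handoffStep.2 h)

/-- **`¬RH ↔` the increment fails at EXACTLY ONE prime.** [this track (theory-1)] -/
theorem not_riemannHypothesis_iff_existsUnique_not_handoffStep :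
    ¬ Summit.RiemannHypothesis ↔ ∃! q : ℕ, q.Prime ∧ ¬ HandoffStep q := by
  constructor
  · intro hRH
    obtain ⟨q, hq, h⟩ := exists_not_handoffStep_of_not_riemannHypothesis hRH
    exact ⟨q, ⟨hq, h⟩, fun q' hq' ↦ eq_of_not_handoffStep hq'.1 hq hq'.2 h⟩
  · rintro ⟨q, ⟨hq, h⟩, -⟩ hRH
    exact h (riemannHypothesis_iff_forall_handoffStep.1 hRH q hq)

/-- `¬RH ↔` some increment fails (and then exactly one does, at a prime `≥ 3`). [this track (theory-1)] -/
theorem not_riemannHypothesis_iff_exists_not_handoffStep :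
    ¬ Summit.RiemannHypothesis ↔ ∃ q : ℕ, q.Prime ∧ 3 ≤ q ∧ ¬ HandoffStep q := by
  constructor
  · intro hRH
    obtain ⟨q, hq, h⟩ := exists_not_handoffStep_of_not_riemannHypothesis hRH
    exact ⟨q, hq, three_le_of_not_handoffStep hq h, h⟩
  · rintro ⟨q, hq, -, h⟩ hRH
    exact h (riemannHypothesis_iff_forall_handoffStep.1 hRH q hq)

/-- The failed increment IS the first failure of `H`: if `¬H′(q)` at a prime `q` then `H(p)` for every prime `p < q`
and `¬H(p)` for every prime `p ≥ q`. [this track (theory-1)] -/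
theorem handoffH_iff_lt_of_not_handoffStep (hq : q.Prime) (h : ¬ HandoffStep q) {p : ℕ} (hp : p.Prime) :
    HandoffH p ↔ p < q := by
  rw [not_handoffStep_iff hq] at h
  constructor
  · intro hH
    by_contra hle
    push Not at hle
    exact h.2 ((handoffH_iff_weilPositivityOn hq).1 (hH.anti hp hq hle))
  · intro hlt
    rw [handoffH_iff_weilPositivityOn hp]
    exact weilPositivityOn_nextPrime_of_lt hq hlt h.1

/-- Conversely, a prime `q` with `H(p) ↔ p < q` for all primes `p` is a failed increment (for `q ≥ 3` the
predecessor prime gives the hypothesis; `q = 2` is excluded by `handoffH_two`). [this track (theory-1)] -/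
theorem not_handoffStep_of_handoffH_iff_lt (hq : q.Prime) (h : ∀ p : ℕ, p.Prime → (HandoffH p ↔ p < q)) :
    ¬ HandoffStep q := by
  have h3 : 3 ≤ q := by
    by_contra h3
    have h2 : q = 2 := by
      have := hq.two_le
      omega
    subst h2
    exact absurd ((h 2 Nat.prime_two).1 handoffH_two) (lt_irrefl 2)
  rw [not_handoffStep_iff hq]
  obtain ⟨p, hp⟩ := Handoff.exists_consecutivePrimes_of_prime hq h3
  refine ⟨?_, fun hW ↦ absurd ((h q hq).1 ((handoffH_iff_weilPositivityOn hq).2 hW)) (lt_irrefl q)⟩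
  have := (handoffH_iff_weilPositivityOn hp.1).1 ((h p hp.1).2 hp.2.2.1)
  rwa [nextPrime_eq_of_consecutivePrimes hp] at this

/-- **The failing step characterised**: for a prime `q`, `¬H′(q) ↔ ∀ primes p, (H(p) ↔ p < q)` — the truth set of
`H` is exactly the set of primes below `q`. [this track (theory-1)] -/
theorem not_handoffStep_iff_forall_handoffH_iff_lt (hq : q.Prime) :
    ¬ HandoffStep q ↔ ∀ p : ℕ, p.Prime → (HandoffH p ↔ p < q) :=
  ⟨fun h _ hp ↦ handoffH_iff_lt_of_not_handoffStep hq h hp, not_handoffStep_of_handoffH_iff_lt hq⟩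

/-! ## §3 The exact content of a tail of increments -/

/-- **TAIL ↔ (RUNG ⟹ RH).**  For a prime `q₀`: the increment holds at every prime `q ≥ q₀` iff Weil positivity on
`C((log q₀)/2)` implies RH.  (`→`: the hybrid target; `←`: a prime `q ≥ q₀` with `WeilPositivityOn((log q)/2)`
has the rung at `q₀` below it, hence RH, hence `H(q)`.) So «prove the increment for all `q ≥ q₀`» means exactly
«prove that the rung at `q₀` implies RH» — no more, no less. [this track (theory-1); Bombieri2000Weil, Thm. 2] -/
theorem forall_ge_handoffStep_iff (hq₀ : q₀.Prime) :
    (∀ q : ℕ, q.Prime → q₀ ≤ q → HandoffStep q) ↔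
      (WeilPositivityOn (Real.log q₀ / 2) → Summit.RiemannHypothesis) := by
  constructor
  · intro h hW
    exact (riemannHypothesis_iff_rung_and_forall_ge_handoffStep hq₀).2 ⟨hW, h⟩
  · intro h q hq hle hWq
    have hW : WeilPositivityOn (Real.log q₀ / 2) := by
      refine hWq.mono ?_
      have h1 : (q₀ : ℝ) ≤ q := by exact_mod_cast hle
      have h0 : (0 : ℝ) < q₀ := by exact_mod_cast hq₀.pos
      linarith [Real.log_le_log h0 h1]
    exact handoffH_of_riemannHypothesis (h hW) hq

/-- The tail from `q₀` fails iff the (unique) failed increment lies at a prime `≥ q₀`. [this track (theory-1)] -/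
theorem not_forall_ge_handoffStep_iff (q₀ : ℕ) :
    (¬ ∀ q : ℕ, q.Prime → q₀ ≤ q → HandoffStep q) ↔ ∃ q : ℕ, q.Prime ∧ q₀ ≤ q ∧ ¬ HandoffStep q := by
  push Not
  rfl

/-- **DICHOTOMY for the truth set of `H`** (unconditional): either `H(q)` for every prime `q` (RH), or there is a
unique prime `q₁ ≥ 3` with `H(p) ↔ p < q₁` for all primes `p` (not RH). [this track (theory-1)] -/
theorem handoffH_truthSet_dichotomy :
    (∀ q : ℕ, q.Prime → HandoffH q) ∨
      ∃! q₁ : ℕ, q₁.Prime ∧ ∀ p : ℕ, p.Prime → (HandoffH p ↔ p < q₁) := by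
  by_cases hRH : Summit.RiemannHypothesis
  · exact Or.inl (riemannHypothesis_iff_forall_handoffH.1 hRH)
  · right
    obtain ⟨q, ⟨hq, h⟩, huniq⟩ := not_riemannHypothesis_iff_existsUnique_not_handoffStep.1 hRH
    refine ⟨q, ⟨hq, (not_handoffStep_iff_forall_handoffH_iff_lt hq).1 h⟩, fun q' hq' ↦ ?_⟩
    exact huniq q' ⟨hq'.1, (not_handoffStep_iff_forall_handoffH_iff_lt hq'.1).2 hq'.2⟩

end HandoffDecomposition

/-! ## §4 The onset dictionary (solo-informed T56) -/

open HandoffDecomposition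

variable {q : ℕ} {a₀ : ℝ}

/-- For an onset window `a₀`, Weil positivity on `C(a)` (`a > 0`) holds iff `a ≤ a₀`. [this track; T56] -/
theorem IsWeilOnset.weilPositivityOn_iff (h : IsWeilOnset a₀) {a : ℝ} (ha : 0 < a) :
    WeilPositivityOn a ↔ a ≤ a₀ :=
  ⟨h.le_of_weilPositivityOn, fun hle ↦ (weilGroundEnergy_nonneg_iff_holds ha).1 (h.nonneg ha hle)⟩

/-- **`H(q) ↔ (log q⁺)/2 ≤ a₀`** for the onset `a₀` and every prime `q`. [this track (theory-1); T56] -/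
theorem IsWeilOnset.handoffH_iff (h : IsWeilOnset a₀) (hq : q.Prime) :
    HandoffH q ↔ Real.log (nextPrime q) / 2 ≤ a₀ := by
  rw [handoffH_iff_weilPositivityOn hq]
  exact h.weilPositivityOn_iff (log_half_pos_of_prime (nextPrime_prime q))

/-- **The failed increment is the prime whose window contains the onset**: `¬H′(q) ↔ (log q)/2 ≤ a₀ < (log q⁺)/2`
(`HANDOFF-STATEMENT.md` §B.5). [this track (theory-1); Yoshida1992HermitianForms, Prop. 6 (p. 320)] -/
theorem IsWeilOnset.not_handoffStep_iff (h : IsWeilOnset a₀) (hq : q.Prime) :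
    ¬ HandoffStep q ↔ Real.log q / 2 ≤ a₀ ∧ a₀ < Real.log (nextPrime q) / 2 := by
  rw [HandoffDecomposition.not_handoffStep_iff hq, h.weilPositivityOn_iff (log_half_pos_of_prime hq),
    h.weilPositivityOn_iff (log_half_pos_of_prime (nextPrime_prime q)), not_le]

/-- Under `¬RH`, with `a₀` the onset: the unique failed increment `q` satisfies `(log q)/2 ≤ a₀ < (log q⁺)/2`, and
`H(p)` holds exactly for the primes `p < q`. [this track (theory-1); T56] -/
theorem IsWeilOnset.exists_failingStep (h : IsWeilOnset a₀) :
    ∃ q : ℕ, q.Prime ∧ 3 ≤ q ∧ Real.log q / 2 ≤ a₀ ∧ a₀ < Real.log (nextPrime q) / 2 ∧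
      ∀ p : ℕ, p.Prime → (HandoffH p ↔ p < q) := by
  obtain ⟨q, hq, h3, hfail⟩ := not_riemannHypothesis_iff_exists_not_handoffStep.1 h.not_riemannHypothesis
  exact ⟨q, hq, h3, ((h.not_handoffStep_iff hq).1 hfail).1, ((h.not_handoffStep_iff hq).1 hfail).2,
    fun p hp ↦ handoffH_iff_lt_of_not_handoffStep hq hfail hp⟩

/-! ## §5 Tails and infinite sets of `H` itself (appended, theory-1 gen8) — the T3 sentences

RH-PROMISE § 0′ T3 asks whether an «`H(q)` for all `q ≥ Q₀`» theorem is RH-equivalent. For the CUMULATIVE clause `H` the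
answer is «it IS RH, for every `Q₀`» — one line from `HandoffH.anti`; recorded here by name so that the T3 text can cite a
declaration rather than a composition. Nothing here is a step towards RH. -/

namespace HandoffDecomposition

/-- **`RH ↔ ∀ primes q ≥ Q, H(q)`, for EVERY `Q`**: a tail of the cumulative clause is the whole clause (`H(q) → H(p)` for
primes `p ≤ q`, `HandoffH.anti`), hence RH (`riemannHypothesis_iff_forall_handoffH`). [this track (theory-1); Bombieri2000Weil, Thm. 2] -/
theorem riemannHypothesis_iff_forall_ge_handoffH (Q : ℕ) :
    Summit.RiemannHypothesis ↔ ∀ q : ℕ, q.Prime → Q ≤ q → HandoffH q := by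
  refine ⟨fun hRH q hq _ ↦ handoffH_of_riemannHypothesis hRH hq, fun h ↦ ?_⟩
  refine riemannHypothesis_iff_forall_handoffH.2 fun p hp ↦ ?_
  obtain ⟨q, hq, hqp⟩ := Nat.exists_infinite_primes (max Q p)
  exact (h q hqp ((le_max_left _ _).trans hq)).anti hqp hp ((le_max_right _ _).trans hq)

/-- **`RH ↔ H(q)` at INFINITELY MANY primes** (`∀ Q, ∃ prime q ≥ Q, H(q)`): `H` on any unbounded set of primes is `H`
everywhere. So every «almost all q», «positive proportion of q», «q in a progression» version of the cumulative clause is RH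
itself — there is no weaker target of this shape. [this track (theory-1); Bombieri2000Weil, Thm. 2] -/
theorem riemannHypothesis_iff_forall_exists_ge_handoffH :
    Summit.RiemannHypothesis ↔ ∀ Q : ℕ, ∃ q : ℕ, Q ≤ q ∧ q.Prime ∧ HandoffH q := by
  constructor
  · intro hRH Q
    obtain ⟨q, hq, hqp⟩ := Nat.exists_infinite_primes Q
    exact ⟨q, hq, hqp, handoffH_of_riemannHypothesis hRH hqp⟩
  · intro h
    refine riemannHypothesis_iff_forall_handoffH.2 fun p hp ↦ ?_
    obtain ⟨q, hpq, hq, hH⟩ := h p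
    exact hH.anti hq hp hpq

/-- Under `¬RH` the cumulative clause FAILS AT EVERY PRIME FROM THE FAILING ONE ON: `∃ q₁` prime (`¬H′(q₁)`) with `¬H(q)`
for all primes `q ≥ q₁` (§2: `H(p) ↔ p < q₁`). [this track (theory-1); Yoshida1992HermitianForms, Prop. 6 (p. 320)] -/
theorem exists_forall_ge_not_handoffH_of_not_riemannHypothesis (hRH : ¬ Summit.RiemannHypothesis) :
    ∃ q₁ : ℕ, q₁.Prime ∧ ¬ HandoffStep q₁ ∧ ∀ q : ℕ, q.Prime → q₁ ≤ q → ¬ HandoffH q := by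
  obtain ⟨q₁, hq₁, hfail⟩ := exists_not_handoffStep_of_not_riemannHypothesis hRH
  exact ⟨q₁, hq₁, hfail, fun q hq hle hH ↦
    absurd ((handoffH_iff_lt_of_not_handoffStep hq₁ hfail hq).1 hH) (not_lt.2 hle)⟩

end HandoffDecomposition

end Summit.RiemannHypothesis.RiemannHypothesis.Theorems

end
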